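import Summits.Ventures.PercRepro.C025ProfileStarReduce
import Summits.Ventures.PercRepro.C025ProfileFourGeom
/-!
# THE RULE `E*_u` ON THE RANK-`u` SETS WITH `≥ u + 2` POINTS — who pays, and at most two of them (night-3 g11)
`proofs/NIGHT3-G11-ESTAR.md` §8. On a rank-`u` set `S` with `|S| ≥ u + 2` a PAIR `B ⊆ S` pays nothing under `E*_u`
(`S ∖ B` has `≥ u` points, but the families of `B` have `u − 2` or `u − 1`), so only FAT sets pay: the `payers` are the
rank-`2` sets `B ⊆ S` with `|B| ≥ 3`, `u ≤ ρ(E∖B)` and `S ∖ B ∈ G_B ∪ P_B`; such a `B` is the whole trace of its line on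
`S` (`payer_trace`), two different payers share at most one point (`card_inter_le_one_of_payers`), and THREE payers
are impossible: with `|B_i| ≥ |S| − u + 1` the union of three lines has rank `≤ 6 + |S| − |B₁| − |B₂| − |B₃|` plus
the remaining points, which is `≤ u − 1 < ρ(S)` (`eRk_le_of_three_payers`, `card_payers_le_two`). The load of `S`
is `Σ_{payers} price(B)/|G_B ∪ P_B|` (`sum_wEstar_eq_sum_payers`); the share bound and the assembly are in
`C025ProfileStarBig`.
-/
open scoped Matroid
namespace PercRepro
open Set Finset ThmH
namespace EStar
variable {α : Type} [DecidableEq α] {M : Matroid α} [M.Finite] {u : ℕ}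

/-! ## Who pays on a big set -/

/-- A pair pays nothing on a set `S` with `|S ∖ B| ≥ u`. -/
theorem wEstar_eq_zero_of_card_two_of_big {B S : Finset α} (hu : 2 ≤ u) (hB2 : B.card = 2)
    (hc : u ≤ (S \ B).card) : wEstar M u B S = 0 := by
  have hG : S \ B ∉ Gfam M u B := by
    intro h; have := (mem_Gfam.1 h).2.1; omega
  have hL : S \ B ∉ Lfam M u B := by
    intro h; have := card_of_mem_Lfam (M := M) h; omega
  have hP : S \ B ∉ Pfam M u B := by
    intro h; have := (mem_Pfam.1 h).2.1; omega
  unfold wEstar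
  split_ifs <;> simp_all

/-- On a fat set the rule is the fat share or `0`. -/
theorem wEstar_of_card_ne_two {B S : Finset α} (hB : B.card ≠ 2) :
    wEstar M u B S = if u ≤ crk M B ∧ S \ B ∈ Gfam M u B ∪ Pfam M u B then
      Profile.price M 2 u B / ((Gfam M u B ∪ Pfam M u B).card : ℚ) else 0 := by
  unfold wEstar
  by_cases hp : crk M B < u
  · rw [if_pos hp, if_neg (by intro h; exact absurd h.1 (not_le.2 hp))]
  · rw [if_neg hp, if_neg hB]
    by_cases hm : S \ B ∈ Gfam M u B ∪ Pfam M u B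
    · rw [if_pos hm, if_pos ⟨not_lt.1 hp, hm⟩]
    · rw [if_neg hm, if_neg (by intro h; exact hm h.2)]

variable (M u) in
open scoped Classical in
/-- The payers of `S`: the fat rank-`2` subsets `B` of `S` with `u ≤ ρ(E∖B)` and `S ∖ B ∈ G_B ∪ P_B`. -/
noncomputable def payers (S : Finset α) : Finset (Finset α) :=
  (Profile.Rq M 2).filter (fun B => B ⊆ S ∧ B.card ≠ 2 ∧ u ≤ crk M B ∧ S \ B ∈ Gfam M u B ∪ Pfam M u B)

/-- Membership in `payers`. -/
theorem mem_payers {S B : Finset α} :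
    B ∈ payers M u S ↔ B ∈ Profile.Rq M 2 ∧ B ⊆ S ∧ B.card ≠ 2 ∧ u ≤ crk M B ∧
      S \ B ∈ Gfam M u B ∪ Pfam M u B := by
  unfold payers; rw [Finset.mem_filter]

/-- On a set with `≥ u + 2` points the load of `E*_u` is the sum of the fat shares of its payers. -/
theorem sum_wEstar_eq_sum_payers {S : Finset α} (hu : 2 ≤ u) (hc : u + 2 ≤ S.card) :
    ∑ B ∈ (Profile.Rq M 2).filter (fun B => B ⊆ S), wEstar M u B S =
      ∑ B ∈ payers M u S, Profile.price M 2 u B / ((Gfam M u B ∪ Pfam M u B).card : ℚ) := by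
  have hval : ∀ B ∈ (Profile.Rq M 2).filter (fun B => B ⊆ S), wEstar M u B S =
      if B ∈ payers M u S then Profile.price M 2 u B / ((Gfam M u B ∪ Pfam M u B).card : ℚ) else 0 := by
    intro B hB
    rw [Finset.mem_filter] at hB
    by_cases hB2 : B.card = 2
    · have hsd : u ≤ (S \ B).card := by rw [Finset.card_sdiff_of_subset hB.2, hB2]; omega
      rw [wEstar_eq_zero_of_card_two_of_big hu hB2 hsd, if_neg]
      intro hp; exact (mem_payers.1 hp).2.2.1 hB2
    · rw [wEstar_of_card_ne_two hB2]
      by_cases hp : B ∈ payers M u S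
      · have h := mem_payers.1 hp
        rw [if_pos ⟨h.2.2.2.1, h.2.2.2.2⟩, if_pos hp]
      · rw [if_neg hp, if_neg]
        intro h
        exact hp (mem_payers.2 ⟨hB.1, hB.2, hB2, h.1, h.2⟩)
  rw [Finset.sum_congr rfl hval, Finset.sum_ite_mem,
    Finset.inter_eq_right.2 (fun B hB => Finset.mem_filter.2 ⟨(mem_payers.1 hB).1, (mem_payers.1 hB).2.1⟩)]

/-! ## The geometry of the payers -/

/-- A payer is the whole trace of its line on `S`: a point of `S` on `cl B` lies in `B`. -/
theorem payer_trace {S B : Finset α} (hB : B ∈ payers M u S) {x : α} (hxS : x ∈ S) (hx : x ∈ clF M B) :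
    x ∈ B := by
  have h := (mem_payers.1 hB).2.2.2.2
  by_contra hxB
  have hmem : x ∈ S \ B := Finset.mem_sdiff.2 ⟨hxS, hxB⟩
  rw [Finset.mem_union] at h
  rcases h with h | h
  · exact (mem_Fs.1 ((mem_Gfam.1 h).1 hmem)).2 hx
  · exact (mem_Fs.1 ((mem_Pfam.1 h).1 hmem)).2 hx

/-- `|S ∖ B| ≤ u − 1` for a payer, so `|B| ≥ |S| − u + 1`. -/
theorem card_sdiff_le_of_payer {S B : Finset α} (hB : B ∈ payers M u S) : (S \ B).card ≤ u - 1 := by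
  have h := (mem_payers.1 hB).2.2.2.2
  rw [Finset.mem_union] at h
  rcases h with h | h
  · have := (mem_Gfam.1 h).2.1; omega
  · have := (mem_Pfam.1 h).2.1; omega

/-- Two different payers share at most one point. -/
theorem card_inter_le_one_of_payers (hsimple : ∀ T ⊆ M.E, T.encard ≤ 2 → M.Indep T) {S B B' : Finset α}
    (hB : B ∈ payers M u S) (hB' : B' ∈ payers M u S) (hne : B ≠ B') : (B ∩ B').card ≤ 1 := by
  by_contra h
  push Not at h
  obtain ⟨hBR, hBS, -⟩ := mem_payers.1 hB
  obtain ⟨hB'R, hB'S, -⟩ := mem_payers.1 hB'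
  obtain ⟨hBg, hB2⟩ := Profile.mem_Rq.1 hBR
  obtain ⟨hB'g, hB'2⟩ := Profile.mem_Rq.1 hB'R
  have h1 : B' ⊆ clF M B := subset_clF_of_two_le_card_inter hsimple hBg hB'g hB2 hB'2 h
  have h2 : B ⊆ clF M B' := subset_clF_of_two_le_card_inter hsimple hB'g hBg hB'2 hB2 (by rw [Finset.inter_comm]; exact h)
  apply hne
  apply le_antisymm
  · intro x hx; exact payer_trace hB' (hBS hx) (h2 hx)
  · intro x hx; exact payer_trace hB (hB'S hx) (h1 hx)

/-- The rank of a finset, as a natural number. -/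
noncomputable def rkN (M : Matroid α) [M.Finite] (X : Finset α) : ℕ := (M.eRk (X : Set α)).toNat

omit [DecidableEq α] in
/-- `↑(rkN M X) = M.eRk ↑X`. -/
theorem coe_rkN (X : Finset α) : ((rkN M X : ℕ) : ℕ∞) = M.eRk (X : Set α) := by
  unfold rkN; exact ENat.coe_toNat (M.isRkFinite_set _).eRk_lt_top.ne

omit [DecidableEq α] in
/-- A set of at most two points of a simple matroid has rank equal to its size. -/
theorem rkN_eq_card_of_card_le_two (hsimple : ∀ T ⊆ M.E, T.encard ≤ 2 → M.Indep T) {T : Finset α}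
    (hTg : T ⊆ gr M) (hT : T.card ≤ 2) : rkN M T = T.card := by
  have hI : M.Indep (T : Set α) := hsimple _ (by rw [← coe_gr]; exact_mod_cast hTg)
    (by rw [Set.encard_coe_eq_coe_finsetCard]; exact_mod_cast hT)
  have h := hI.eRk_eq_encard
  rw [Set.encard_coe_eq_coe_finsetCard] at h
  unfold rkN; rw [h, ENat.toNat_coe]

/-- Submodularity in natural numbers: `ρ(X ∪ Y) + ρ(X ∩ Y) ≤ ρ(X) + ρ(Y)`. -/
theorem rkN_union_add_rkN_inter_le (X Y : Finset α) :
    rkN M (X ∪ Y) + rkN M (X ∩ Y) ≤ rkN M X + rkN M Y := by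
  have h := M.eRk_inter_add_eRk_union_le (X : Set α) (Y : Set α)
  rw [← Finset.coe_inter, ← Finset.coe_union, ← coe_rkN, ← coe_rkN, ← coe_rkN, ← coe_rkN] at h
  have h' : ((rkN M (X ∩ Y) + rkN M (X ∪ Y) : ℕ) : ℕ∞) ≤ ((rkN M X + rkN M Y : ℕ) : ℕ∞) := by
    push_cast; exact h
  have := (Nat.cast_le (α := ℕ∞)).1 h'
  omega

/-- `ρ(S) ≤ ρ(U) + |S ∖ U|`. -/
theorem rkN_le_rkN_add_card_sdiff (S U : Finset α) : rkN M S ≤ rkN M U + (S \ U).card := by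
  have h1 : M.eRk (S : Set α) ≤ M.eRk ((U ∪ (S \ U) : Finset α) : Set α) :=
    M.eRk_mono (by intro x hx; rw [Finset.mem_coe] at hx ⊢; rw [Finset.mem_union, Finset.mem_sdiff]; tauto)
  have h2 : M.eRk ((U ∪ (S \ U) : Finset α) : Set α) ≤ M.eRk (U : Set α) + M.eRk ((S \ U : Finset α) : Set α) := by
    rw [Finset.coe_union]; exact M.eRk_union_le_eRk_add_eRk _ _
  have h3 : M.eRk ((S \ U : Finset α) : Set α) ≤ ((S \ U).card : ℕ∞) := by
    refine (M.eRk_le_encard _).trans ?_; rw [Set.encard_coe_eq_coe_finsetCard]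
  have h : M.eRk (S : Set α) ≤ M.eRk (U : Set α) + ((S \ U).card : ℕ∞) :=
    h1.trans (h2.trans (add_le_add (le_refl _) h3))
  rw [← coe_rkN, ← coe_rkN] at h
  have h' : ((rkN M S : ℕ) : ℕ∞) ≤ ((rkN M U + (S \ U).card : ℕ) : ℕ∞) := by push_cast; exact h
  exact (Nat.cast_le (α := ℕ∞)).1 h'

/-- **Three payers cannot coexist**: for three pairwise different payers of a set `S` with `≥ u + 2` points,
`ρ(S) ≤ u − 1`. -/
theorem rkN_le_of_three_payers (hsimple : ∀ T ⊆ M.E, T.encard ≤ 2 → M.Indep T) {S B₁ B₂ B₃ : Finset α}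
    (hSg : S ⊆ gr M) (hc : u + 2 ≤ S.card)
    (h1 : B₁ ∈ payers M u S) (h2 : B₂ ∈ payers M u S) (h3 : B₃ ∈ payers M u S)
    (h12 : B₁ ≠ B₂) (h13 : B₁ ≠ B₃) (h23 : B₂ ≠ B₃) : rkN M S + 1 ≤ u := by
  obtain ⟨h1R, h1S, -⟩ := mem_payers.1 h1
  obtain ⟨h2R, h2S, -⟩ := mem_payers.1 h2
  obtain ⟨h3R, h3S, -⟩ := mem_payers.1 h3
  have r1 : rkN M B₁ = 2 := by unfold rkN; rw [(Profile.mem_Rq.1 h1R).2]; rfl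
  have r2 : rkN M B₂ = 2 := by unfold rkN; rw [(Profile.mem_Rq.1 h2R).2]; rfl
  have r3 : rkN M B₃ = 2 := by unfold rkN; rw [(Profile.mem_Rq.1 h3R).2]; rfl
  -- the sizes of the payers
  have c1 := card_sdiff_le_of_payer h1
  have c2 := card_sdiff_le_of_payer h2
  have c3 := card_sdiff_le_of_payer h3
  have e1 := Finset.card_sdiff_add_card_eq_card h1S
  have e2 := Finset.card_sdiff_add_card_eq_card h2S
  have e3 := Finset.card_sdiff_add_card_eq_card h3S
  -- the intersections
  have i12 := card_inter_le_one_of_payers hsimple h1 h2 h12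
  have i13 := card_inter_le_one_of_payers hsimple h1 h3 h13
  have i23 := card_inter_le_one_of_payers hsimple h2 h3 h23
  have hXS : B₁ ∪ B₂ ⊆ S := Finset.union_subset h1S h2S
  have hXB₃ : ((B₁ ∪ B₂) ∩ B₃).card ≤ 2 := by
    have : (B₁ ∪ B₂) ∩ B₃ ⊆ (B₁ ∩ B₃) ∪ (B₂ ∩ B₃) := by
      intro x hx; rw [Finset.mem_inter, Finset.mem_union] at hx
      rw [Finset.mem_union, Finset.mem_inter, Finset.mem_inter]; tauto
    exact (Finset.card_le_card this).trans ((Finset.card_union_le _ _).trans (by omega))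
  -- ranks of the small intersections
  have ri12 : rkN M (B₁ ∩ B₂) = (B₁ ∩ B₂).card :=
    rkN_eq_card_of_card_le_two hsimple ((Finset.inter_subset_left).trans (h1S.trans hSg)) (by omega)
  have riX3 : rkN M ((B₁ ∪ B₂) ∩ B₃) = ((B₁ ∪ B₂) ∩ B₃).card :=
    rkN_eq_card_of_card_le_two hsimple ((Finset.inter_subset_left).trans (hXS.trans hSg)) hXB₃
  -- submodularity twice
  have s1 := rkN_union_add_rkN_inter_le (M := M) B₁ B₂
  have s2 := rkN_union_add_rkN_inter_le (M := M) (B₁ ∪ B₂) B₃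
  -- the union and its size
  have hUS : B₁ ∪ B₂ ∪ B₃ ⊆ S := Finset.union_subset hXS h3S
  have cu1 := Finset.card_union_add_card_inter B₁ B₂
  have cu2 := Finset.card_union_add_card_inter (B₁ ∪ B₂) B₃
  have hSU := rkN_le_rkN_add_card_sdiff (M := M) S (B₁ ∪ B₂ ∪ B₃)
  have eU := Finset.card_sdiff_add_card_eq_card hUS
  rw [ri12, r1, r2] at s1
  rw [riX3, r3] at s2
  omega

/-- **At most two payers** on a rank-`u` set with `≥ u + 2` points. -/
theorem card_payers_le_two (hsimple : ∀ T ⊆ M.E, T.encard ≤ 2 → M.Indep T) {S : Finset α}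
    (hS : S ∈ Shadow.levelSet M u) (hc : u + 2 ≤ S.card) : (payers M u S).card ≤ 2 := by
  obtain ⟨hSg, hSu⟩ := Profile.mem_levelSet.1 hS
  have hr : rkN M S = u := by unfold rkN; rw [hSu, ENat.toNat_coe]
  by_contra h
  push Not at h
  obtain ⟨B₁, h1, B₂, h2, B₃, h3, h12, h13, h23⟩ := Finset.two_lt_card.1 h
  have := rkN_le_of_three_payers hsimple hSg hc h1 h2 h3 h12 h13 h23
  omega

end EStar
end PercRepro
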